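import Summits.KontsevichZagierPeriods.KontsevichZagierPeriods.Theses.LiouvilleUnfolding

/-!
# Sketch (ideator 3, crux LogPrimitiveNL = stmt-KontsevichZagierPeriods-2836): first lemmas of two idea cards

* card `rational-point-baker-syzygies`: `BoundaryCollapse`, `BakerCollapse`, `LogSyzygyStructure`,
  and the transfer target `SyzygyUnrolling` (C⁺).
* card `echelon-unrolling`: `MonomialRelationUnrolling`, `MinNormalisedEndpointIntegrable`.

Nothing is proved here; every `def` is a `Prop` that must ELABORATE over existing declarations.
-/

noncomputable section

open Set MeasureTheory

namespace Summit.KontsevichZagierPeriods.KontsevichZagierPeriods.Cruxes.LogPrimitiveNL.IdeaSketch3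

open Literature.NumberTheory.Transcendental
open Literature.ModelTheory.ExponentialFields (IsSemialgebraic)

/-- Card A, step S0.  A `ℚ`-semialgebraic function on an open set which equals a combination
`Σ hᵢ log Wᵢ` with `ℚ`-semialgebraic continuous coefficients/arguments vanishes identically:
at every RATIONAL point its value is algebraic and is a linear form in logarithms of algebraic
numbers with algebraic coefficients, hence `0` by Baker 1975 Thm 2.2 (`baker_holds`); rational
points are dense in an open set and everything is continuous. -/
def BoundaryCollapse : Prop :=
  ∀ (n k : ℕ) (U : Set (Fin n → ℝ)) (F : (Fin n → ℝ) → ℝ) (h W : Fin k → (Fin n → ℝ) → ℝ),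
    IsOpen U → IsSemialgebraic ℚ U → IsSemialgebraicFunOn ℚ U F → ContinuousOn F U →
    (∀ i, IsSemialgebraicFunOn ℚ U (h i)) → (∀ i, ContinuousOn (h i) U) →
    (∀ i, IsSemialgebraicFunOn ℚ U (W i)) → (∀ i, ContinuousOn (W i) U) →
    (∀ i, ∀ x ∈ U, 0 < W i x) →
    (∀ x ∈ U, F x = ∑ i, h i x * Real.log (W i x)) →
    ∀ x ∈ U, F x = 0

/-- Card A, step S2 (the atom that replaces "Baker in families").  Constant real-algebraic
coefficients `γₗ` linearly independent over `ℚ`, positive continuous `ℚ`-semialgebraic `Uₗ` on an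
open set with `Σ γₗ log Uₗ ≡ 0`: then every `Uₗ ≡ 1`.  Proof: at a rational point `x₀` the numbers
`λₗ = log Uₗ(x₀)` are logarithms of algebraic numbers; Baker (`baker_holds`) = injectivity of
`ℚ̄ ⊗_ℚ 𝔏 → ℂ`, and `Σ γₗ ⊗ λₗ = 0` with `γ` `ℚ`-free forces every `λₗ = 0`; then density of
`ℚⁿ` and continuity. -/
def BakerCollapse : Prop :=
  ∀ (n p : ℕ) (U : Set (Fin n → ℝ)) (γ : Fin p → ℝ) (Ul : Fin p → (Fin n → ℝ) → ℝ),
    IsOpen U → IsSemialgebraic ℚ U → (∀ l, IsAlgebraic ℚ (γ l)) → LinearIndependent ℚ γ →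
    (∀ l, IsSemialgebraicFunOn ℚ U (Ul l)) → (∀ l, ContinuousOn (Ul l) U) →
    (∀ l, ∀ x ∈ U, 0 < Ul l x) →
    (∀ x ∈ U, ∑ l, γ l * Real.log (Ul l x) = 0) →
    ∀ l, ∀ x ∈ U, Ul l x = 1

/-- Card A, step S2 — the STRUCTURE THEOREM in the form the Kolchin–Ostrowski induction proves it
(no analyticity, no identity principle, no "maximal free subfamily"): an inhomogeneous log-relation
`g₀ + Σⱼ gⱼ log Wⱼ ≡ 0` among `C^∞` `ℚ`-semialgebraic functions on an open `ℚ`-semialgebraic set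
splits, on finitely many open semialgebraic cells exhausting it up to a null set, as: `g₀ ≡ 0` and
the coefficient vector is a `ℚ`-semialgebraic combination of EXACT integer monomial relations of
that cell (`g ∈ K ⊗ Λ₁(cell)`).  Induction on `m`: divide by `g_m` on `{g_m ≠ 0}`, differentiate,
apply the case `m − 1` to the derivative, project the coefficient vector along `Λ₁(W_{<m}) ⊗ ℚ`
(which does not change the relation) so that its derivative vanishes ⇒ constant real-algebraic
coefficients; the inhomogeneous part dies by Baker Thm 2.2 at rational points; `BakerCollapse`
turns the constant relation into an integer one. -/
def LogSyzygyStructure : Prop :=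
  ∀ (n m : ℕ) (U : Set (Fin n → ℝ)) (g₀ : (Fin n → ℝ) → ℝ) (g W : Fin m → (Fin n → ℝ) → ℝ),
    IsOpen U → IsSemialgebraic ℚ U → IsSemialgebraicFunOn ℚ U g₀ → ContDiffOn ℝ ⊤ g₀ U →
    (∀ j, IsSemialgebraicFunOn ℚ U (g j)) → (∀ j, ContDiffOn ℝ ⊤ (g j) U) →
    (∀ j, IsSemialgebraicFunOn ℚ U (W j)) → (∀ j, ContDiffOn ℝ ⊤ (W j) U) →
    (∀ j, ∀ x ∈ U, 0 < W j x) →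
    (∀ x ∈ U, g₀ x + ∑ j, g j x * Real.log (W j x) = 0) →
    ∃ (N : ℕ) (C : Fin N → Set (Fin n → ℝ)),
      (∀ κ, IsOpen (C κ) ∧ IsConnected (C κ) ∧ IsSemialgebraic ℚ (C κ) ∧ C κ ⊆ U) ∧
      volume (U \ ⋃ κ, C κ) = 0 ∧
      ∀ κ, (∀ x ∈ C κ, g₀ x = 0) ∧
        ∃ (S : Finset (Fin m → ℤ)) (f : (Fin m → ℤ) → (Fin n → ℝ) → ℝ),
          (∀ e ∈ S, ∀ x ∈ C κ, ∏ j, W j x ^ (e j) = 1) ∧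
          (∀ e ∈ S, IsSemialgebraicFunOn ℚ (C κ) (f e)) ∧
          ∀ j, ∀ x ∈ C κ, g j x = ∑ e ∈ S, f e x * (e j : ℝ)

/-- Card A, TRANSFER TARGET `C⁺` (what LogPrimitiveNL becomes once `r'` has collapsed and the tree
engine has unfolded the logs): a finite family of honest monomial representations
`ρⱼ = [{x ∈ σ, 1 ≤ u ≤ Wⱼ x}, gⱼ(x)/u]` whose fibre integrals `Σⱼ gⱼ log Wⱼ` vanish identically on
`σ` sums to a relation. -/
def SyzygyUnrolling : Prop :=
  ∀ (n m : ℕ) (σ : Set (Fin n → ℝ)) (g W : Fin m → (Fin n → ℝ) → ℝ)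
    (ρ : Fin m → KZ.IntegralRep (n + 1)),
    IsSemialgebraic ℚ σ → (∀ j, IsSemialgebraicFunOn ℚ σ (g j)) →
    (∀ j, IsSemialgebraicFunOn ℚ σ (W j)) → (∀ j, ∀ x ∈ σ, 1 ≤ W j x) →
    (∀ x ∈ σ, ∑ j, g j x * Real.log (W j x) = 0) →
    (∀ j, (ρ j).domain =
      {z | (Fin.init z : Fin n → ℝ) ∈ σ ∧ 1 ≤ z (Fin.last n) ∧ z (Fin.last n) ≤ W j (Fin.init z)}) →
    (∀ j, EqOn (ρ j).integrand (fun z => g j (Fin.init z) / z (Fin.last n)) (ρ j).domain) →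
    ∑ j, KZ.of (ρ j) ∈ KZ.relations

/-- Card B, first lemma.  ONE exact monomial relation `∏ Wⱼ ^ eⱼ ≡ 1` (integer exponents, all
`Wⱼ ≥ 1`) with a common coefficient `f` such that EVERY `[{1 ≤ u ≤ Wⱼ}, f/u]` is an honest
(absolutely convergent) representation unrolls to a relation: group positive and negative
exponents, `P = ∏_{e>0} Wⱼ^{eⱼ} = ∏_{e<0} Wⱼ^{-eⱼ} = Q` is one function, and the tree product rule
`KZ.of_sub_of_sub_mem_relations_mul` peels `[P, f]` both ways through integrable intermediates. -/
def MonomialRelationUnrolling : Prop :=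
  ∀ (n m : ℕ) (σ : Set (Fin n → ℝ)) (f : (Fin n → ℝ) → ℝ) (W : Fin m → (Fin n → ℝ) → ℝ)
    (e : Fin m → ℤ) (ρ : Fin m → KZ.IntegralRep (n + 1)),
    IsSemialgebraic ℚ σ → IsSemialgebraicFunOn ℚ σ f → (∀ j, IsSemialgebraicFunOn ℚ σ (W j)) →
    (∀ j, ∀ x ∈ σ, 1 ≤ W j x) → (∀ x ∈ σ, ∏ j, W j x ^ (e j) = 1) →
    (∀ j, (ρ j).domain =
      {z | (Fin.init z : Fin n → ℝ) ∈ σ ∧ 1 ≤ z (Fin.last n) ∧ z (Fin.last n) ≤ W j (Fin.init z)}) →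
    (∀ j, EqOn (ρ j).integrand (fun z => f (Fin.init z) / z (Fin.last n)) (ρ j).domain) →
    ∑ j, e j • KZ.of (ρ j) ∈ KZ.relations

/-- Card B, step S1 (why the min-normalisation makes the tree engine's outputs honest).  Under the
fibrewise hypotheses of LogPrimitiveNL for one monomial, with `m x = min_{[a x, b x]} V(x,·)`, the
endpoint coefficient `h · log (V(·, b ·)/m)` is absolutely integrable on the base — it is dominated
by `∫_{a x}^{b x} |h V'/V| dt`, whose base integral is the given `IntegrableOn` of `h V'/V` on the
band (Tonelli).  (Semialgebraicity of `m` is Tarski–Seidenberg: `IsSemialgebraic.image_tail`.) -/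
def MinNormalisedEndpointIntegrable : Prop :=
  ∀ (n : ℕ) (τ : Set (Fin n → ℝ)) (a b h : (Fin n → ℝ) → ℝ) (V V' : (Fin (n + 1) → ℝ) → ℝ),
    IsSemialgebraic ℚ τ → (∀ x ∈ τ, a x ≤ b x) →
    (∀ z ∈ {z : Fin (n + 1) → ℝ | (Fin.init z : Fin n → ℝ) ∈ τ ∧ a (Fin.init z) ≤ z (Fin.last n) ∧
        z (Fin.last n) ≤ b (Fin.init z)}, 0 < V z) →
    (∀ x ∈ τ, ContinuousOn (fun t : ℝ => V (Fin.snoc x t)) (Icc (a x) (b x))) →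
    (∀ x ∈ τ, ∀ t ∈ Ioo (a x) (b x),
      HasDerivAt (fun s : ℝ => V (Fin.snoc x s)) (V' (Fin.snoc x t)) t) →
    IntegrableOn (fun z => h (Fin.init z) * V' z / V z)
      {z : Fin (n + 1) → ℝ | (Fin.init z : Fin n → ℝ) ∈ τ ∧ a (Fin.init z) ≤ z (Fin.last n) ∧
        z (Fin.last n) ≤ b (Fin.init z)} →
    IntegrableOn (fun x => h x * Real.log (V (Fin.snoc x (b x)) /
        sInf ((fun t : ℝ => V (Fin.snoc x t)) '' Icc (a x) (b x)))) τ

/-- Sanity: the crux decl is in scope under its route name. -/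
example : Prop := Summit.KontsevichZagierPeriods.KontsevichZagierPeriods.Theses.LiouvilleUnfolding.LogPrimitiveNL

end Summit.KontsevichZagierPeriods.KontsevichZagierPeriods.Cruxes.LogPrimitiveNL.IdeaSketch3
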